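import Summits.SmoothPoincare4.SmoothPoincare4.Theses.SymplecticOrigami
import Summits.SmoothPoincare4.SmoothPoincare4.Theorems.OrigamiRung.Negative.RefutationCost
import Summits.SmoothPoincare4.SmoothPoincare4.Theorems.OrigamiRung.Negative.GenusTable
import Summits.SmoothPoincare4.SmoothPoincare4.Theorems.OrigamiRung.Negative.MeridianPinch
import Summits.SmoothPoincare4.SmoothPoincare4.Theorems.SymplecticOrigamiOrigamiRungStubSides
import Summits.SmoothPoincare4.SmoothPoincare4.Theorems.SymplecticOrigamiOrigamiRungStubSphereOfGenusZero
import Summits.SmoothPoincare4.SmoothPoincare4.Theorems.SymplecticOrigamiOrigamiRungStubBallFunction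
import Summits.SmoothPoincare4.SmoothPoincare4.Theorems.SymplecticOrigamiOrigamiRungStubBallOfSublevel
import Summits.SmoothPoincare4.SmoothPoincare4.Theorems.SymplecticOrigamiOrigamiRungStubGenusFormula
import Summits.SmoothPoincare4.SmoothPoincare4.Theorems.SymplecticOrigamiOrigamiRungStubPinchPieceHomeomorph
import Summits.SmoothPoincare4.SmoothPoincare4.Theorems.SymplecticOrigamiOrigamiRungStubPinchFoldSubmersion
import Summits.SmoothPoincare4.SmoothPoincare4.Theorems.SymplecticOrigamiOrigamiRungStubPinchBlowdownQuotient
import Literature.Topology.FourManifolds.SchoenfliesTools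
import Literature.Topology.FourManifolds.AkbulutKirbyCerfReduction
import Literature.Topology.FourManifolds.HomotopyS4CompactProofs
import Literature.Topology.FourManifolds.InvertedGermExtension
import Literature.Topology.FourManifolds.Morse
import Literature.AlgebraicTopology.SingularHomology.Orientation
import Literature.AlgebraicTopology.SingularHomology.PoincareDuality
import Literature.AlgebraicTopology.SingularHomology.DisjointCarriersCupPairing
import Literature.AlgebraicTopology.SingularHomology.ModPBettiNumbers
import Literature.AlgebraicTopology.SingularHomology.RationalEulerCharacteristic
import Literature.Geometry.Symplectic.CanonicalClassSqAndAdjunctionOfSymplecticFour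
import Literature.Geometry.Symplectic.ThomGysinComplementSurfaceFour
import Literature.Geometry.Symplectic.EulerCharacteristicAddSignatureOfSymplecticFour
import Summits.SmoothPoincare4.SmoothPoincare4.Theorems.SymplecticOrigamiOrigamiRungStubPinchAlexander
import Summits.SmoothPoincare4.SmoothPoincare4.Theorems.SymplecticOrigamiOrigamiRungPinchOfParity

/-!
# Crux `SymplecticOrigami.OrigamiRung` by line `pair-rigidity-endgame` — the assembled proof,
# modulo the route's two named-fact items and two Literature facts

Item stmt-SmoothPoincare4-7843 (route `route-SmoothPoincare4-SymplecticOrigami`; idea card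
`Cruxes/OrigamiRung/Ideas/pair-rigidity-endgame.md`; skeleton `Cruxes/OrigamiRung/Lines/pair_rigidity_endgame.lean`).

`OrigamiRung_of hMW hC hK hPar : OrigamiRung` — a smooth homotopy 4-sphere `M` carrying the FOLD
DATA of the route (`M ∖ Z = V 0 ⊔ V 1`, blow-downs `β i : M → N i` onto closed symplectic
`(N i, s i)` collapsing `Z` onto symplectic surfaces `B i = range (b i)`, `dβ i` of corank `1`
along `Z`) is diffeomorphic to `S⁴`, or both pieces are doors (`(b₁, b₂)(N i) = (2, 1)`), GRANTED

* `hMW : McDuffWendlAffinePair` — route item stmt-SmoothPoincare4-14052 (McDuff 1990 / Wendl 2018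
  Thm. D(2), affine complement form);
* `hC : CerfGammaFour` — route item stmt-SmoothPoincare4-8758 (= the tree fact
  `cerf_twistedSphere_four`, `cerfGammaFour_iff`);
* `hK : Literature.Geometry.Symplectic.canonicalClass_sq_and_adjunction_of_symplectic_four` —
  Literature fact (McDuff–Salamon 2017 (4.1.7), (4.4.5); used only by the genus formula);
* `hPar : Literature.Geometry.Symplectic.even_one_add_bOne_add_bPlus_of_symplectic_four` —
  Literature fact (`χ + σ ≡ 0 (4)`, McDuff–Salamon 2017 §13.3 p. 527; used only by the pinch).

Everything else is PROVED in the tree and imported: the stubs of the line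
(`stub_sides`, `stub_sphereOfGenusZero`, `stub_ballFunction`, `stub_ballOfSublevel`,
`stub_genusFormula_of_canonicalClass_of_thomGysin` — with the Thom–Gysin premise discharged by
`thomGysin_complement_surface_four_holds` —, `stub_pinch_of_parity` over `stub_pinch_sepFun`,
`stub_pinch_alexander`, `stub_pinch_exceptionalNbhdIso`, `stub_pinch_pieceLES`,
`stub_pinch_surfaceNbhdPair`), Cerf's theorem in twisted-sphere form, the twisted-sphere
assembly `SchoenfliesTools.exists_isTwistedSphere`.

Composition: pinch ⇒ `(g, k)`; genus formula on both pieces ⇒ `genus_arith` ⇒ `g = 2` (doors,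
right disjunct) or `g = 0`: spheres (`stub_sphereOfGenusZero`), `H₁(N i ∖ B i) = 0`, `hMW` ⇒
affine pair structures, `ballPiece` (= `stub_ballFunction` + `stub_ballOfSublevel`) ⇒ two
embedded closed balls covering `M` and meeting exactly along `Z` ⇒ `IsTwistedSphere 3 φ M` ⇒
`M ≅ S⁴` (`hC`).
-/

noncomputable section

-- the prescribed namespace `Summit.<P>.<Sub>.…` duplicates `SmoothPoincare4` (P = Sub)
set_option linter.dupNamespace false

open scoped Manifold ContDiff Topology ContinuousMap
open Set TopologicalSpace
open Literature.Topology.FourManifolds (singularHomologyZ sphereInversion IsTwistedSphere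
  cerf_twistedSphere_four)
open Literature.Geometry.Kaehler (MForm IsSmoothForm IsClosedForm)
open Literature.AlgebraicTopology.SingularHomology (singularHomology HomologicalOrientation
  singularCohomology poincareDualityMap cupPairing intersectionForm)
open Summit.SmoothPoincare4.SmoothPoincare4.Theorems.OrigamiRung.PairRigidityEndgame
  (stub_sides stub_sphereOfGenusZero stub_ballFunction stub_ballOfSublevel
   stub_genusFormula_of_canonicalClass_of_thomGysin stub_pinch_pieceHomeomorph
   stub_pinch_foldSubmersion stub_pinch_blowdownQuotient stub_pinch_alexander stub_pinch_of_parity)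

namespace Summit.SmoothPoincare4.SmoothPoincare4.Theorems.OrigamiRung.PairRigidityEndgame


/-- The route item `CerfGammaFour` is literally the tree's named fact `cerf_twistedSphere_four`. -/
theorem cerfGammaFour_iff :
    Summit.SmoothPoincare4.SmoothPoincare4.Theses.SymplecticOrigami.CerfGammaFour ↔
      cerf_twistedSphere_four :=
  Iff.rfl

/-! ## All stubs of the line are landed under `Theorems/` and imported above:
`stub_sides`, `stub_sphereOfGenusZero`, `stub_ballFunction`, `stub_ballOfSublevel`,
`stub_genusFormula_of_canonicalClass_of_thomGysin`, `stub_pinch_sepFun`, `stub_pinch_alexander`,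
`stub_pinch_exceptionalNbhd(Iso)`, `stub_pinch_pieceLES`, `stub_pinch_surfaceNbhdPair`,
`stub_pinch_of_parity` (namespace `…Theorems.OrigamiRung.PairRigidityEndgame`). -/

/-! ## Derived lemmas over the landed stubs -/

/-- **The ball piece** (the r1 Stub 4, DERIVED from the landed 4a + 4b): fold data
(non-symplectic clauses) + sides + an affine pair structure on `(N i, B i)` ⇒ `closure (V i)` is
the image of a smooth embedding of the closed 4-ball whose boundary sphere goes onto `Z`.
[folklore] -/
theorem ballPiece :
    ∀ (M : Type) [TopologicalSpace M] [T2Space M] [SecondCountableTopology M] [CompactSpace M]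
      [ConnectedSpace M] [ChartedSpace (EuclideanSpace ℝ (Fin 4)) M] [IsManifold (𝓡 4) ∞ M]
      (V : Fin 2 → Opens M) (N : Fin 2 → Type) [∀ i, TopologicalSpace (N i)]
      [∀ i, T2Space (N i)] [∀ i, SecondCountableTopology (N i)] [∀ i, CompactSpace (N i)]
      [∀ i, ConnectedSpace (N i)] [∀ i, ChartedSpace (EuclideanSpace ℝ (Fin 4)) (N i)] [∀ i, IsManifold (𝓡 4) ∞ (N i)]
      (S : Fin 2 → Type) [∀ i, TopologicalSpace (S i)] [∀ i, CompactSpace (S i)]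
      [∀ i, ConnectedSpace (S i)] [∀ i, ChartedSpace (EuclideanSpace ℝ (Fin 2)) (S i)] [∀ i, IsManifold (𝓡 2) ∞ (S i)]
      (b : ∀ i, S i → N i) (β : ∀ i, M → N i),
      (Disjoint (V 0) (V 1) ∧ (∀ i, (V i : Set M).Nonempty) ∧
        IsConnected ((V 0 : Set M) ∪ (V 1 : Set M))ᶜ ∧
        (∃ (Z : Type) (_ : TopologicalSpace Z) (_ : ChartedSpace (EuclideanSpace ℝ (Fin 3)) Z)
          (_ : IsManifold (𝓡 3) ∞ Z) (z : Z → M), Manifold.IsSmoothEmbedding (𝓡 3) (𝓡 4) ∞ z ∧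
            Set.range z = ((V 0 : Set M) ∪ (V 1 : Set M))ᶜ)) →
      (∀ i, Manifold.IsSmoothEmbedding (𝓡 2) (𝓡 4) ∞ (b i) ∧
        (∃ U : Set M, IsOpen U ∧ closure (V i : Set M) ⊆ U ∧ ContMDiffOn (𝓡 4) (𝓡 4) ∞ (β i) U) ∧
        Set.InjOn (β i) (V i : Set M) ∧ β i '' (V i : Set M) = (Set.range (b i))ᶜ ∧
        (∀ x ∈ (V i : Set M), Function.Bijective (mfderiv (𝓡 4) (𝓡 4) (β i) x)) ∧
        β i '' frontier (V i : Set M) ⊆ Set.range (b i) ∧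
        (∀ x ∈ frontier (V i : Set M),
          Module.finrank ℝ (LinearMap.ker (mfderiv (𝓡 4) (𝓡 4) (β i) x).toLinearMap) = 1)) →
      (∀ i, frontier (V i : Set M) = ((V 0 : Set M) ∪ (V 1 : Set M))ᶜ ∧
        interior (closure (V i : Set M)) = (V i : Set M)) →
      ∀ i, (∃ (Ψ Θ : N i → EuclideanSpace ℝ (Fin 4)) (W : Set (N i)),
          ContMDiffOn (𝓡 4) 𝓘(ℝ, EuclideanSpace ℝ (Fin 4)) ∞ Ψ (Set.range (b i))ᶜ ∧ Set.InjOn Ψ (Set.range (b i))ᶜ ∧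
          Ψ '' (Set.range (b i))ᶜ = Set.univ ∧
          (∀ x ∈ (Set.range (b i))ᶜ, Function.Bijective (mfderiv (𝓡 4) 𝓘(ℝ, EuclideanSpace ℝ (Fin 4)) Ψ x)) ∧
          IsOpen W ∧ Set.range (b i) ⊆ W ∧ ContMDiffOn (𝓡 4) 𝓘(ℝ, EuclideanSpace ℝ (Fin 4)) ∞ Θ W ∧
          (∀ x ∈ W \ Set.range (b i), Θ x = sphereInversion (Ψ x)) ∧
          (∀ x ∈ Set.range (b i), Θ x = 0 ∧
            Module.finrank ℝ (LinearMap.ker (mfderiv (𝓡 4) 𝓘(ℝ, EuclideanSpace ℝ (Fin 4)) Θ x).toLinearMap) = 2)) →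
        ∃ j : (Metric.closedBall (0 : EuclideanSpace ℝ (Fin (3 + 1))) 1) → M, Manifold.IsSmoothEmbedding (𝓡∂ (3 + 1)) (𝓡 (3 + 1)) ∞ j ∧
          Set.range j = closure (V i : Set M) ∧
          Set.range (j ∘ Set.inclusion (Metric.sphere_subset_closedBall :
              Metric.sphere (0 : EuclideanSpace ℝ (Fin (3 + 1))) 1 ⊆ Metric.closedBall 0 1)) =
            ((V 0 : Set M) ∪ (V 1 : Set M))ᶜ := by
  intro M _ _ _ _ _ _ _ V N _ _ _ _ _ _ _ S _ _ _ _ _ b β hdata hβ hsides i hA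
  obtain ⟨Ω, f, p, hΩ, hf, hcl, hle, heq, hpV, hfp, huniq, hcrit, hpos⟩ :=
    stub_ballFunction M V N S b β hdata hβ hsides i hA
  have hcpt : IsCompact {x | x ∈ Ω ∧ f x ≤ 0} := by
    rw [hle]; exact isClosed_closure.isCompact
  obtain ⟨j, hj, hrange, hsph⟩ :=
    stub_ballOfSublevel M Ω f p hΩ hf hcpt (hcl (subset_closure hpV)) hfp huniq hcrit hpos
  exact ⟨j, hj, hrange.trans hle, hsph.trans heq⟩

/-! ## Arithmetic of the genus dichotomy (proved) -/

/-- **The genus dichotomy is arithmetic** once `stub_pinch` and `stub_genusFormula` have spoken: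
`k₀ + g² = 3g = k₁ + g²` and `k₀ + k₁ = 2g` force `(g, k₀, k₁) = (0, 0, 0)` or `(2, 2, 2)`
(`g = 1`: `2 + 2 ≠ 2`; `g = 3`: `0 + 0 ≠ 6`; `g ≥ 4`: `g² > 3g`). -/
theorem genus_arith (g k₀ k₁ : ℕ) (h₀ : k₀ + g * g = 3 * g) (h₁ : k₁ + g * g = 3 * g)
    (hs : k₀ + k₁ = 2 * g) :
    (g = 0 ∧ k₀ = 0 ∧ k₁ = 0) ∨ (g = 2 ∧ k₀ = 2 ∧ k₁ = 2) := by
  have hg : g ≤ 3 := by nlinarith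
  interval_cases g <;> omega

/-! ## Composition: the crux BY NAME -/

/-- **`OrigamiRung` from the registered stubs (by name) and the landed ones, under the two route
items** (`McDuffWendlAffinePair`, stmt-14052; `CerfGammaFour`, stmt-8758 = `cerf_twistedSphere_four`)
**and the two Literature facts `hK` (Chern package, for the genus formula) and `hPar` (parity, for
the pinch)**; the Thom–Gysin premise of the genus formula is the tree's theorem
`thomGysin_complement_surface_four_holds`.  Sorry-free.
Route: pinch ⇒ `(g, k)`; genus formula on both pieces ⇒ `genus_arith` ⇒ `g = 2` (doors) or
`g = 0`: spheres (`stub_sphereOfGenusZero`), `H₁(N i ∖ B i) = 0`, `hMW` ⇒ affine pair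
structures, `ballPiece` ⇒ two embedded closed balls covering `M` and meeting only along `Z` ⇒
`IsTwistedSphere 3 φ M` (`SchoenfliesTools.exists_isTwistedSphere`) ⇒ `M ≅ S⁴` (`hC`). -/
theorem OrigamiRung_of
    (hMW : Summit.SmoothPoincare4.SmoothPoincare4.Theses.SymplecticOrigami.McDuffWendlAffinePair)
    (hC : Summit.SmoothPoincare4.SmoothPoincare4.Theses.SymplecticOrigami.CerfGammaFour)
    (hK : Literature.Geometry.Symplectic.canonicalClass_sq_and_adjunction_of_symplectic_four)
    (hPar : Literature.Geometry.Symplectic.even_one_add_bOne_add_bPlus_of_symplectic_four) :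
    Summit.SmoothPoincare4.SmoothPoincare4.Theses.SymplecticOrigami.OrigamiRung := by
  have hT := Literature.Geometry.Symplectic.thomGysin_complement_surface_four_holds
  intro M _ _ _ _ _ e V N _ _ _ _ _ _ _ s S _ _ _ _ _ b β hdata hprops
  haveI : CompactSpace M :=
    Literature.Topology.FourManifolds.compactSpace_of_homotopyEquiv_sphere_four_holds M e
  haveI : PathConnectedSpace M := by
    haveI := Literature.Topology.FourManifolds.pathConnectedSpace_sphere_four
    exact Literature.Topology.FourManifolds.pathConnectedSpace_of_homotopyEquiv e
  -- sides of the fold (landed Stub 0): `frontier (V i) = Z` and `V i` regular-open, for both `i`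
  have hsides : ∀ i, frontier (V i : Set M) = ((V 0 : Set M) ∪ (V 1 : Set M))ᶜ ∧
      interior (closure (V i : Set M)) = (V i : Set M) := by
    obtain ⟨Z, _, _, _, z, hz, hrange⟩ := hdata.2.2.2
    intro i
    obtain ⟨h1, h2⟩ := stub_sides M V Z z hdata.1 hdata.2.1 hdata.2.2.1 hz hrange i
    exact ⟨h1.trans hrange, h2⟩
  obtain ⟨g, k, hsum, hpieces⟩ := stub_pinch_of_parity hPar M e V N s S b β hdata hprops hsides
  have hgen : ∀ i, k i + g * g = 3 * g ∧ Module.finrank ℤ (singularHomologyZ (N i) 1) = k i :=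
    fun i => stub_genusFormula_of_canonicalClass_of_thomGysin hK hT (N i) (s i) (S i) (b i)
      (hprops i).1 (hprops i).2.1 (hprops i).2.2.1 (hprops i).2.2.2.1 (hprops i).2.2.2.2.1
      (hpieces i).2.1 g (k i) (hpieces i).1 (hpieces i).2.2
  rcases genus_arith g (k 0) (k 1) (hgen 0).1 (hgen 1).1 hsum with ⟨hg, hk0, hk1⟩ | ⟨hg, hk0, hk1⟩
  · -- genus 0: the endgame
    left
    have hk : ∀ i, k i = 0 := fun i => by fin_cases i <;> assumption
    -- each closed piece is an embedded closed 4-ball with boundary sphere onto `Z`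
    have hball : ∀ i, ∃ j : (Metric.closedBall (0 : EuclideanSpace ℝ (Fin (3 + 1))) 1) → M, Manifold.IsSmoothEmbedding (𝓡∂ (3 + 1)) (𝓡 (3 + 1)) ∞ j ∧
        Set.range j = closure (V i : Set M) ∧
        Set.range (j ∘ Set.inclusion (Metric.sphere_subset_closedBall :
            Metric.sphere (0 : EuclideanSpace ℝ (Fin (3 + 1))) 1 ⊆ Metric.closedBall 0 1)) =
          ((V 0 : Set M) ∪ (V 1 : Set M))ᶜ := by
      intro i
      have hsph : Nonempty (S i ≃ₘ⟮𝓡 2, 𝓡 2⟯ (Metric.sphere (0 : EuclideanSpace ℝ (Fin 3)) 1)) :=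
        stub_sphereOfGenusZero (N i) (s i) (S i) (b i) (hprops i).1 (hprops i).2.2.2.1
          (hprops i).2.2.2.2.1 (by rw [(hpieces i).1, hg])
      have hsub : Subsingleton (singularHomologyZ (↥((Set.range (b i))ᶜ)) 1) := by
        obtain ⟨ε⟩ := (hpieces i).2.2
        haveI : Subsingleton (Fin (k i) → ℤ) := by rw [hk i]; infer_instance
        exact ε.toEquiv.subsingleton
      have hA := hMW (N i) (s i) (S i) (b i) (hprops i).1 (hprops i).2.1 (hprops i).2.2.1
        (hprops i).2.2.2.1 (hprops i).2.2.2.2.1 hsph (hpieces i).2.1 hsub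
      exact ballPiece M V N S b β hdata (fun i => ⟨(hprops i).2.2.2.1, (hprops i).2.2.2.2.2⟩)
        hsides i hA
    choose j hj using hball
    -- the two balls cover `M` and meet exactly along `Z` = both boundary spheres: a twisted sphere
    have hZ : ∀ i, ((V 0 : Set M) ∪ (V 1 : Set M))ᶜ ⊆ Set.range (j i) := fun i => by
      rw [← (hj i).2.2]
      exact Set.range_comp_subset_range _ _
    have hcover : Set.range (j 0) ∪ Set.range (j 1) = Set.univ := by
      apply Set.eq_univ_of_forall
      intro x
      by_cases hx : x ∈ (V 0 : Set M) ∪ (V 1 : Set M)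
      · rcases hx with hx | hx
        · left; rw [(hj 0).2.1]; exact subset_closure hx
        · right; rw [(hj 1).2.1]; exact subset_closure hx
      · exact Or.inl (hZ 0 hx)
    have hdisj : Disjoint (V 0 : Set M) (V 1 : Set M) := Opens.coe_disjoint.2 hdata.1
    have hmeet : ∀ x, x ∈ closure (V 0 : Set M) → x ∈ closure (V 1 : Set M) →
        x ∈ ((V 0 : Set M) ∪ (V 1 : Set M))ᶜ := by
      intro x h0 h1 hx
      rcases hx with hx | hx
      · obtain ⟨y, hy0, hy1⟩ := mem_closure_iff.1 h1 (V 0 : Set M) (V 0).isOpen hx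
        exact Set.disjoint_left.1 hdisj hy0 hy1
      · obtain ⟨y, hy1, hy0⟩ := mem_closure_iff.1 h0 (V 1 : Set M) (V 1).isOpen hx
        exact Set.disjoint_left.1 hdisj hy0 hy1
    have hAB : ∀ a c, j 0 a = j 1 c →
        ‖(a : EuclideanSpace ℝ (Fin (3 + 1)))‖ = 1 ∧ ‖(c : EuclideanSpace ℝ (Fin (3 + 1)))‖ = 1 := by
      intro a c hac
      have h0 : j 0 a ∈ closure (V 0 : Set M) := by rw [← (hj 0).2.1]; exact ⟨a, rfl⟩
      have h1 : j 0 a ∈ closure (V 1 : Set M) := by rw [← (hj 1).2.1, hac]; exact ⟨c, rfl⟩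
      have hxZ := hmeet _ h0 h1
      constructor
      · have hx : j 0 a ∈ Set.range (j 0 ∘ Set.inclusion (Metric.sphere_subset_closedBall :
            Metric.sphere (0 : EuclideanSpace ℝ (Fin (3 + 1))) 1 ⊆ Metric.closedBall 0 1)) := by
          rw [(hj 0).2.2]; exact hxZ
        obtain ⟨a', ha'⟩ := hx
        have : Set.inclusion Metric.sphere_subset_closedBall a' = a :=
          (hj 0).1.isEmbedding.injective ha'
        rw [← this]
        exact mem_sphere_zero_iff_norm.1 a'.2
      · have hx : j 1 c ∈ Set.range (j 1 ∘ Set.inclusion (Metric.sphere_subset_closedBall :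
            Metric.sphere (0 : EuclideanSpace ℝ (Fin (3 + 1))) 1 ⊆ Metric.closedBall 0 1)) := by
          rw [(hj 1).2.2, ← hac]; exact hxZ
        obtain ⟨c', hc'⟩ := hx
        have : Set.inclusion Metric.sphere_subset_closedBall c' = c :=
          (hj 1).1.isEmbedding.injective hc'
        rw [← this]
        exact mem_sphere_zero_iff_norm.1 c'.2
    have hcirc : Set.range (j 0 ∘ Set.inclusion (Metric.sphere_subset_closedBall :
            Metric.sphere (0 : EuclideanSpace ℝ (Fin (3 + 1))) 1 ⊆ Metric.closedBall 0 1)) =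
        Set.range (j 1 ∘ Set.inclusion (Metric.sphere_subset_closedBall :
            Metric.sphere (0 : EuclideanSpace ℝ (Fin (3 + 1))) 1 ⊆ Metric.closedBall 0 1)) := by
      rw [(hj 0).2.2, (hj 1).2.2]
    obtain ⟨φ, hT⟩ :=
      Literature.Topology.FourManifolds.SchoenfliesTools.exists_isTwistedSphere
        (hj 0).1 (hj 1).1 hcover hAB hcirc
    exact Literature.Topology.FourManifolds.nonempty_diffeomorph_sphere_four_of_isTwistedSphere_of_cerf
      (cerfGammaFour_iff.1 hC) hT
  · -- genus 2: both pieces are doors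
    right
    intro i
    refine ⟨?_, (hpieces i).2.1⟩
    rw [(hgen i).2]
    fin_cases i <;> assumption

/-- The skeleton over the tree's Cerf fact directly. -/
example (hMW : Summit.SmoothPoincare4.SmoothPoincare4.Theses.SymplecticOrigami.McDuffWendlAffinePair)
    (hC : cerf_twistedSphere_four)
    (hK : Literature.Geometry.Symplectic.canonicalClass_sq_and_adjunction_of_symplectic_four)
    (hPar : Literature.Geometry.Symplectic.even_one_add_bOne_add_bPlus_of_symplectic_four) :
    Summit.SmoothPoincare4.SmoothPoincare4.Theses.SymplecticOrigami.OrigamiRung :=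
  OrigamiRung_of hMW (cerfGammaFour_iff.2 hC) hK hPar

end Summit.SmoothPoincare4.SmoothPoincare4.Theorems.OrigamiRung.PairRigidityEndgame

end
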